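import Literature.Probability.Percolation.MixedIsoradialLattice
import Literature.Probability.LatticeModels.IsoradialGraphsProofs
import Literature.Probability.LatticeModels.IsoradialPercolationProofs
import Literature.Probability.LatticeModels.IsoradialSquareGrid
import Literature.Probability.LatticeModels.RhombicTrackTransport
import Literature.Probability.RandomPlanarGeometry.PolygonWinding
import HarnessLib

/-!
# Grimmett–Manolescu's isoradial square lattices `G_{α,β}`

Topic `Literature/Probability/Percolation`. G. R. Grimmett, I. Manolescu, *Bond percolation on
isoradial graphs: criticality and universality*, PTRF 159 (2014) 273–327 = arXiv:1204.0505,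
§4.6 "Isoradial square lattices": an isoradial square lattice (an isoradial embedding of `ℤ²`;
"isoradial square lattices, and only these graphs, have a square grid as track-system") is
described by its horizontal tracks `(s_j : j ∈ ℤ)` with transverse angles `β_j` and its vertical
tracks `(t_i : i ∈ ℤ)` with transverse angles `γ_i = π + α_i`; the vertex of the diamond graph
adjacent to `t_{i-1}, t_i, s_{j-1}, s_j` is `v_{i,j}` (`v_{0,0}` primal), the rhombus `t_i ∩ s_j` has
internal angles `β_j - α_i` and `π - (β_j - α_i)`, "thus `G` satisfies BAP(ε) if and only if
`β_j - α_i ∈ [ε, π - ε]`" (4.5), and "conversely, for two vectors `α, β` satisfying (4.5), we may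
construct the diamond graph `G^◇_{α,β}` … This gives rise to an isoradial square lattice denoted
`G_{α,β}` … We write `P_{α,β}` for the canonical measure of `G_{α,β}`." These lattices — with one
of the two sequences modified above a level, `G_{α,β̃}` — carry the whole track-exchange argument
of §6 (Props. 6.1, 6.4, 6.8: transport of box crossings between `P_{α,β̄}` and `P_{α,β}`), and
reappear in §7 ("`G^K` agrees with `G_{α,β}` inside this domain"). This file constructs `G_{α,β}`
in the vocabulary of the tree — a `RhombicEmbedding (zdGraph 2) (Site 2)`
(`Literature.Probability.LatticeModels.IsoradialGraphs`) — and proves its printed properties.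

## Coordinates

The diamond vertex `v_{i,j}` sits at `D(i, j) = H_α(i) + H_β(j)` (`gmDiamond`), where
`H_θ(n) = Σ_{k<n} e^{iθ_k}` is the track height of `MixedIsoradialLattice` (`trackHeight`):
crossing `t_i` rightwards adds the unit side `e^{iα_i}`, crossing `s_j` upwards adds `e^{iβ_j}`.
The site `(x, y)` of the abstract `ℤ²` (`zdGraph 2`) is the primal vertex `v_{x-y, x+y}`
(`gmVertex`); the face with lower-left corner `f` (the face bookkeeping `squareLeftFace` of
`squareLatticeEmbedding` is reused verbatim) is the dual vertex `v_{f₀-f₁, f₀+f₁+1}` (`gmFace`). So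
the horizontal edge `(x,y)–(x+1,y)` of `ℤ²` is the diagonal `v_{i,j} v_{i+1,j+1}` of the rhombus
`t_i ∩ s_j` and the vertical edge `(x,y)–(x,y+1)` the diagonal `v_{i,j} v_{i-1,j+1}` of
`t_{i-1} ∩ s_j` (`columnIndex`, `trackIndex`). For `α ≡ 0` this is the lattice `𝕃(𝛃)` of
Duminil-Copin–Kozlowski–Krachun–Manolescu–Oulamara (`gmVertex_zero_left`: `gmVertex 0 β =
mixedPoint 1 β`), and `G_{-π/4, π/4}` is *equal* to the tree's `squareLatticeEmbedding`
(`gmEmbedding_squareLattice`).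

## Contents (all proved; hypotheses are the printed (4.5))

The qualitative form of (4.5) is `∀ i j, β_j - α_i ∈ (0, π)`; the quantitative form is written in
the half-angle units of the tree's `HasBoundedAngles ε` (half-angles in `[ε, π/2 - ε]`, i.e.
rhombus angles in `[2ε, π - 2ε]`): `∀ i j, β_j - α_i ∈ [2ε, π - 2ε]`.

* `gmDiamond_injective`, `gmVertex_injective`, `gmFace_injective` — the diamond vertices are
  pairwise distinct when `sin (β_j - α_i) > 0`: a coincidence would equate a sum `A` of consecutive
  `e^{iα}`'s with `±` a sum `B` of consecutive `e^{iβ}`'s, but the planar cross product gives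
  `A × B = Σ Σ sin (β_l - α_k) > 0` while `A × (±A) = 0` (`cross_exp_exp`).
* `gm_dart_geometry` — the rhombus of every dart in coordinates: unit sides `e^{iφ}` (right) and
  `e^{i(φ+Θ)}` (left) at the tail, `Θ = gmDartAngle d ∈ {β_j - α_i, π - (β_j - α_i)}` the rhombus
  angle at the tail (four cases: east/north/west/south darts of `ℤ²`).
* `isIsoradial_gmEmbedding` — `G_{α,β}` is an isoradial embedding (`IsIsoradial`) under (4.5);
  `halfAngle_gmEmbedding` — `halfAngle d = Θ_d / 2`; `hasBoundedAngles_gmEmbedding_iff` — **BAP(ε)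
  iff (4.5)** (`ε > 0`), both directions.
* `gmWeight`, `edgeWeight_gmEmbedding`, `isoradialPercolation_gmEmbedding` — the canonical
  measure `P_{α,β}` is the product measure with intensity `p_{β_j-α_i} = criticalWeightI ((β_j-α_i)/2)`
  on the horizontal edge in `t_i ∩ s_j` and `p_{π-(β_j-α_i)}` on the vertical edge in `t_i ∩ s_j`
  ((2.2) in the tree's half-angle convention `criticalWeightI`); for `α ≡ 0` these are DKKMO's
  `mixedWeight`/`mixedPercolation` (`isoradialPercolation_gmEmbedding_zero_left`), which are thereby
  identified as the canonical isoradial measure of a genuine rhombic embedding.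
* `squareGridPropertyGM_gmEmbedding` — SGP(1) (the track predicates only see the face
  bookkeeping, shared with `squareLatticeEmbedding`: `isSideCompatible_squareLattice_gmEmbedding` and
  the transport of `RhombicTrackTransport`); `gmEmbedding_preconnected`.

## Not here

The rhombic-tiling condition `IsRhombicTiling` for `G_{α,β}` (rhombus interiors pairwise
disjoint, rhombi covering the plane — the planarity half of "we may construct the diamond graph
`G^◇_{α,β}` as in Figure 4.4", a strip-by-strip argument on the rows `s_j`) is the sequel of this
file; the converse identification of an arbitrary rhombic tiling with SGP(1) with some `G_{α,β}`
(§4.6, first sentence), and the track exchanges `Σ_j` of §5.3 acting on `G_{α,β}`, are not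
formalised here. No named fact is introduced.

## References

* G. R. Grimmett, I. Manolescu, *Bond percolation on isoradial graphs: criticality and
  universality*, PTRF 159 (2014) 273–327, arXiv:1204.0505: §4.6 (isoradial square lattices,
  `v_{i,j}`, (4.5), `G_{α,β}`, `P_{α,β}`), §4.3.1, §2.2 (2.2) (canonical weights), §6.1.
* H. Duminil-Copin, K. K. Kozlowski, D. Krachun, I. Manolescu, M. Oulamara, *Rotational invariance
  in critical planar lattice models*, arXiv:2012.11672v2, §2.1–2.2 (the lattices `𝕃(𝛂)`).
* R. Kenyon, J.-M. Schlenker, *Rhombic embeddings of planar quad-graphs*, TAMS 357 (2005), §1.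
-/

noncomputable section

open Complex
open scoped Real

namespace Literature.Probability.Percolation

open LatticeModels LatticeModels.RhombicEmbedding
open Literature.Probability.RandomPlanarGeometry (cross)

/-! ### Unit vectors and the planar cross product -/

/-- The unit vector `e^{iθ}`. [folklore] -/
theorem exp_mul_I_re_im (θ : ℝ) :
    (cexp ((θ : ℂ) * I)).re = Real.cos θ ∧ (cexp ((θ : ℂ) * I)).im = Real.sin θ :=
  ⟨Complex.exp_ofReal_mul_I_re θ, Complex.exp_ofReal_mul_I_im θ⟩

/-- **The cross product of two unit vectors is the sine of the angle between them**:
`e^{iα} × e^{iβ} = sin (β - α)`. [folklore] -/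
theorem cross_exp_exp (α β : ℝ) :
    cross (cexp ((α : ℂ) * I)) (cexp ((β : ℂ) * I)) = Real.sin (β - α) := by
  obtain ⟨h1, h2⟩ := exp_mul_I_re_im α
  obtain ⟨h3, h4⟩ := exp_mul_I_re_im β
  rw [cross, h1, h2, h3, h4, Real.sin_sub]
  ring

/-- The cross product is additive on the left. [folklore] -/
theorem cross_add_left (u u' v : ℂ) : cross (u + u') v = cross u v + cross u' v := by
  simp only [cross, Complex.add_re, Complex.add_im]; ring

/-- The cross product is additive on the right. [folklore] -/
theorem cross_add_right (u v v' : ℂ) : cross u (v + v') = cross u v + cross u v' := by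
  simp only [cross, Complex.add_re, Complex.add_im]; ring

/-- The cross product of a vector with itself vanishes. [folklore] -/
theorem cross_self (u : ℂ) : cross u u = 0 := by rw [cross]; ring

/-- The cross product is antisymmetric. [folklore] -/
theorem cross_comm (u v : ℂ) : cross u v = -cross v u := by simp only [cross]; ring

/-- `(-u) × v = -(u × v)`. [folklore] -/
theorem cross_neg_left (u v : ℂ) : cross (-u) v = -cross u v := by
  simp only [cross, Complex.neg_re, Complex.neg_im]; ring

/-- `u × (-v) = -(u × v)`. [folklore] -/
theorem cross_neg_right (u v : ℂ) : cross u (-v) = -cross u v := by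
  simp only [cross, Complex.neg_re, Complex.neg_im]; ring

/-- The cross product is a sum on the left. [folklore] -/
theorem cross_sum_left {ι : Type*} (s : Finset ι) (u : ι → ℂ) (v : ℂ) :
    cross (∑ k ∈ s, u k) v = ∑ k ∈ s, cross (u k) v := by
  classical
  induction s using Finset.induction_on with
  | empty => simp [cross]
  | insert a s ha ih => rw [Finset.sum_insert ha, Finset.sum_insert ha, cross_add_left, ih]

/-- The cross product is a sum on the right. [folklore] -/
theorem cross_sum_right {ι : Type*} (s : Finset ι) (u : ℂ) (v : ι → ℂ) :
    cross u (∑ k ∈ s, v k) = ∑ k ∈ s, cross u (v k) := by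
  classical
  induction s using Finset.induction_on with
  | empty => simp [cross]
  | insert a s ha ih => rw [Finset.sum_insert ha, Finset.sum_insert ha, cross_add_right, ih]

/-! ### Track heights: sums of consecutive unit vectors -/

/-- `H(i + m) = H(i) + Σ_{k<m} e^{iα_{i+k}}`. [cite: arXiv201211672v2, §2.1] -/
theorem trackHeight_add_natCast (αs : ℤ → ℝ) (i : ℤ) (m : ℕ) :
    trackHeight αs (i + m) = trackHeight αs i + ∑ k ∈ Finset.range m, cexp ((αs (i + k) : ℂ) * I) := by
  induction m with
  | zero => simp
  | succ m ih =>
    rw [Finset.sum_range_succ, Nat.cast_succ, ← add_assoc, trackHeight_add_one, ih]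
    ring

/-! ### The diamond graph of `G_{α,β}` -/

/-- **The vertex `v_{i,j}` of the diamond graph `G^◇_{α,β}`** (Grimmett–Manolescu 2014, §4.6): the
vertex adjacent to the tracks `t_{i-1}, t_i, s_{j-1}, s_j` sits at
`D(i, j) = H_α(i) + H_β(j) = Σ_{i'<i} e^{iα_{i'}} + Σ_{j'<j} e^{iβ_{j'}}` — crossing the vertical
track `t_i` rightwards adds its unit side `e^{iα_i}` (`α_i = γ_i - π`, `γ_i` the transverse
angle of `t_i`), crossing the horizontal track `s_j` upwards adds `e^{iβ_j}` (`β_j` the transverse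
angle of `s_j`). Primal vertices are the `v_{i,j}` with `i + j` even.
[cite: GrimmettManolescu2014Isoradial, §4.6 (v_{i,j}, G^◇_{α,β}, Figure 4.4)] -/
def gmDiamond (α β : ℤ → ℝ) (i j : ℤ) : ℂ := trackHeight α i + trackHeight β j

/-- Crossing `t_i` rightwards: `D(i+1, j) = D(i, j) + e^{iα_i}`. [cite: GrimmettManolescu2014Isoradial, §4.6] -/
theorem gmDiamond_add_one_left (α β : ℤ → ℝ) (i j : ℤ) :
    gmDiamond α β (i + 1) j = gmDiamond α β i j + cexp ((α i : ℂ) * I) := by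
  rw [gmDiamond, gmDiamond, trackHeight_add_one]; ring

/-- Crossing `s_j` upwards: `D(i, j+1) = D(i, j) + e^{iβ_j}`. [cite: GrimmettManolescu2014Isoradial, §4.6] -/
theorem gmDiamond_add_one_right (α β : ℤ → ℝ) (i j : ℤ) :
    gmDiamond α β i (j + 1) = gmDiamond α β i j + cexp ((β j : ℂ) * I) := by
  rw [gmDiamond, gmDiamond, trackHeight_add_one]; ring

/-- `D(i + m, j + n) = D(i, j) + Σ_{k<m} e^{iα_{i+k}} + Σ_{l<n} e^{iβ_{j+l}}`. [cite: GrimmettManolescu2014Isoradial, §4.6] -/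
theorem gmDiamond_add_natCast (α β : ℤ → ℝ) (i j : ℤ) (m n : ℕ) :
    gmDiamond α β (i + m) (j + n) = gmDiamond α β i j +
      ∑ k ∈ Finset.range m, cexp ((α (i + k) : ℂ) * I) +
      ∑ l ∈ Finset.range n, cexp ((β (j + l) : ℂ) * I) := by
  rw [gmDiamond, gmDiamond, trackHeight_add_natCast, trackHeight_add_natCast]; ring

/-- **The diamond vertices `v_{i,j}` are pairwise distinct** as soon as every horizontal track
crosses every vertical track positively, `sin (β_j - α_i) > 0` (which is (4.5) of the paper):
if `D(i,j) = D(i',j')` then a sum `A` of consecutive `e^{iα}`'s equals `±` a sum `B` of consecutive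
`e^{iβ}`'s, and the cross product `A × B = Σ Σ sin (β_l - α_k) > 0` unless one of the sums is
empty, while `A × (±A) = 0`. [cite: GrimmettManolescu2014Isoradial, §4.6 with (4.5)] -/
theorem gmDiamond_injective {α β : ℤ → ℝ} (h : ∀ i j, 0 < Real.sin (β j - α i)) :
    Function.Injective (fun p : ℤ × ℤ => gmDiamond α β p.1 p.2) := by
  -- the basic computation: `(Σ_{k<m} a_{i+k}) × (Σ_{l<n} b_{j+l}) > 0` for `m, n > 0`, `= 0` if
  -- one of them vanishes
  have hpos : ∀ (i j : ℤ) (m n : ℕ), 0 < m → 0 < n →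
      0 < cross (∑ k ∈ Finset.range m, cexp ((α (i + k) : ℂ) * I))
        (∑ l ∈ Finset.range n, cexp ((β (j + l) : ℂ) * I)) := by
    intro i j m n hm hn
    rw [cross_sum_left]
    refine Finset.sum_pos (fun k _ => ?_) (Finset.nonempty_range_iff.2 hm.ne')
    rw [cross_sum_right]
    exact Finset.sum_pos (fun l _ => by rw [cross_exp_exp]; exact h _ _)
      (Finset.nonempty_range_iff.2 hn.ne')
  -- reduction to `i ≤ i'`
  suffices key : ∀ (i j : ℤ) (m : ℕ) (j' : ℤ), gmDiamond α β i j = gmDiamond α β (i + m) j' →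
      m = 0 ∧ j = j' by
    rintro ⟨i, j⟩ ⟨i', j'⟩ hij
    simp only at hij
    rcases le_or_gt i i' with hii | hii
    · obtain ⟨m, rfl⟩ := Int.exists_add_of_le hii  -- hmm gives i' = i + m with m : ℕ? check
      obtain ⟨hm, hj⟩ := key i j m j' hij
      subst hm hj; simp
    · obtain ⟨m, rfl⟩ := Int.exists_add_of_le hii.le
      obtain ⟨hm, hj⟩ := key i' j' m j hij.symm
      subst hm hj; simp
  intro i j m j' hD
  rcases le_or_gt j j' with hjj | hjj
  · obtain ⟨n, rfl⟩ := Int.exists_add_of_le hjj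
    -- `A + B = 0`
    have hAB : ∑ k ∈ Finset.range m, cexp ((α (i + k) : ℂ) * I) +
        ∑ l ∈ Finset.range n, cexp ((β (j + l) : ℂ) * I) = 0 := by
      have := gmDiamond_add_natCast α β i j m n
      rw [← hD] at this
      linear_combination -this
    set A := ∑ k ∈ Finset.range m, cexp ((α (i + k) : ℂ) * I) with hA
    set B := ∑ l ∈ Finset.range n, cexp ((β (j + l) : ℂ) * I) with hB
    have hBA : B = -A := by linear_combination hAB
    rcases Nat.eq_zero_or_pos m with hm | hm
    · subst hm
      refine ⟨rfl, ?_⟩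
      rcases Nat.eq_zero_or_pos n with hn | hn
      · subst hn; simp
      · exfalso
        have hB0 : B = 0 := by rw [hBA, hA]; simp
        have : 0 < cross (cexp ((α i : ℂ) * I)) B := by
          rw [hB, cross_sum_right]
          exact Finset.sum_pos (fun l _ => by rw [cross_exp_exp]; exact h _ _)
            (Finset.nonempty_range_iff.2 hn.ne')
        rw [hB0] at this
        simp [cross] at this
    · exfalso
      rcases Nat.eq_zero_or_pos n with hn | hn
      · subst hn
        have hA0 : A = 0 := by rw [hB] at hBA; simpa using hBA
        have : 0 < cross A (cexp ((β j : ℂ) * I)) := by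
          rw [hA, cross_sum_left]
          exact Finset.sum_pos (fun k _ => by rw [cross_exp_exp]; exact h _ _)
            (Finset.nonempty_range_iff.2 hm.ne')
        rw [hA0] at this
        simp [cross] at this
      · have := hpos i j m n hm hn
        rw [← hA, ← hB, hBA, cross_neg_right, cross_self, neg_zero] at this
        exact lt_irrefl _ this
  · obtain ⟨n, rfl⟩ := Int.exists_add_of_le hjj.le
    -- `B = A`
    exfalso
    have hAB : ∑ k ∈ Finset.range m, cexp ((α (i + k) : ℂ) * I) =
        ∑ l ∈ Finset.range n, cexp ((β (j' + l) : ℂ) * I) := by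
      have h1 := gmDiamond_add_natCast α β i j' m 0
      have h2 := gmDiamond_add_natCast α β i j' 0 n
      simp only [Nat.cast_zero, add_zero, Finset.range_zero, Finset.sum_empty] at h1 h2
      rw [← hD, h2] at h1
      linear_combination -h1
    have hn : 0 < n := by
      rcases Nat.eq_zero_or_pos n with hn | hn
      · subst hn; simp at hjj
      · exact hn
    rcases Nat.eq_zero_or_pos m with hm | hm
    · subst hm
      simp only [Finset.range_zero, Finset.sum_empty] at hAB
      have : 0 < cross (cexp ((α i : ℂ) * I)) (∑ l ∈ Finset.range n, cexp ((β (j' + l) : ℂ) * I)) := by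
        rw [cross_sum_right]
        exact Finset.sum_pos (fun l _ => by rw [cross_exp_exp]; exact h _ _)
          (Finset.nonempty_range_iff.2 hn.ne')
      rw [← hAB] at this
      simp [cross] at this
    · have := hpos i j' m n hm hn
      rw [← hAB, cross_self] at this
      exact lt_irrefl _ this

/-! ### The rhombic embedding `G_{α,β}` of `ℤ²` -/

/-- The site `(x, y)` of the abstract square lattice `ℤ²` is the primal diamond vertex `v_{i,j}`
with `i = x - y`, `j = x + y` (so that `i + j` is even, and the edges `(x,y)–(x+1,y)`,
`(x,y)–(x,y+1)` of `ℤ²` are the diagonals `v_{i,j} v_{i+1,j+1}`, `v_{i,j} v_{i-1,j+1}` of the rhombi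
`t_i ∩ s_j`, `t_{i-1} ∩ s_j`). Its position in `G_{α,β}`. [cite: GrimmettManolescu2014Isoradial, §4.6 (v_{0,0} primal; G_{α,β})] -/
def gmVertex (α β : ℤ → ℝ) (x : Site 2) : ℂ := gmDiamond α β (x 0 - x 1) (x 0 + x 1)

/-- The face of `ℤ²` with lower-left corner `f` is the dual diamond vertex `v_{i,j+1}`,
`i = f₀ - f₁`, `j = f₀ + f₁` (the common neighbour of the four corners of the square). Its
position (the circumcentre of the face) in `G_{α,β}`. [cite: GrimmettManolescu2014Isoradial, §4.6] -/
def gmFace (α β : ℤ → ℝ) (f : Site 2) : ℂ := gmDiamond α β (f 0 - f 1) (f 0 + f 1 + 1)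

/-- **Grimmett–Manolescu's isoradial square lattice `G_{α,β}`** as a rhombic embedding of the
abstract square lattice `zdGraph 2`, with the face bookkeeping of `squareLatticeEmbedding`
(faces indexed by their lower-left corner, `squareLeftFace`): the diamond graph `G^◇_{α,β}` has
the vertical tracks `t_i` with unit sides `e^{iα_i}` and the horizontal tracks `s_j` with unit sides
`e^{iβ_j}`; for `β_j - α_i ∈ (0, π)` it is an isoradial embedding whose rhombus `t_i ∩ s_j` has
angles `β_j - α_i` and `π - (β_j - α_i)` (`isIsoradial_gmEmbedding`, `halfAngle_gmEmbedding`), so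
that `G_{α,β}` satisfies BAP(`ε`) iff `β_j - α_i ∈ [2ε, π - 2ε]` in the half-angle units of the
tree (`hasBoundedAngles_gmEmbedding_iff`, the paper's (4.5)). The case `α ≡ 0` is DKKMO's
`𝕃(𝛃)` (`gmVertex_zero_left`), and constant sequences `-π/4, π/4` give `squareLatticeEmbedding`.
[cite: GrimmettManolescu2014Isoradial, §4.6 ("for two vectors α, β satisfying (4.5), we may construct the diamond graph G^◇_{α,β} … an isoradial square lattice G_{α,β}")] -/
def gmEmbedding (α β : ℤ → ℝ) : RhombicEmbedding (zdGraph 2) (Site 2) where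
  z := gmVertex α β
  c := gmFace α β
  leftFace d := squareLeftFace d.fst d.snd
  rightFace d := squareLeftFace d.snd d.fst

section Unfold

variable (α β : ℤ → ℝ)

/-- Unfolding `z`. [folklore] -/
@[simp] theorem gmEmbedding_z (x : Site 2) : (gmEmbedding α β).z x = gmVertex α β x := rfl

/-- Unfolding `c`. [folklore] -/
@[simp] theorem gmEmbedding_c (f : Site 2) : (gmEmbedding α β).c f = gmFace α β f := rfl

/-- Unfolding `leftFace`. [folklore] -/
@[simp] theorem gmEmbedding_leftFace (d : (zdGraph 2).Dart) :
    (gmEmbedding α β).leftFace d = squareLeftFace d.fst d.snd := rfl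

/-- Unfolding `rightFace`. [folklore] -/
@[simp] theorem gmEmbedding_rightFace (d : (zdGraph 2).Dart) :
    (gmEmbedding α β).rightFace d = squareLeftFace d.snd d.fst := rfl

/-- `z(x + e₀) = D(i,j) + e^{iβ_j} + e^{iα_i}` (`= D(i+1, j+1)`). [cite: GrimmettManolescu2014Isoradial, §4.6] -/
theorem gmVertex_add_single_zero (x : Site 2) :
    gmVertex α β (x + Pi.single 0 1) =
      gmVertex α β x + cexp ((β (x 0 + x 1) : ℂ) * I) + cexp ((α (x 0 - x 1) : ℂ) * I) := by
  simp only [gmVertex, Pi.add_apply, Pi.single_eq_same,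
    Pi.single_eq_of_ne (one_ne_zero : (1 : Fin 2) ≠ 0)]
  rw [show x 0 + 1 - (x 1 + 0) = x 0 - x 1 + 1 by ring, show x 0 + 1 + (x 1 + 0) = x 0 + x 1 + 1 by ring,
    gmDiamond_add_one_left, gmDiamond_add_one_right]

/-- `z(x + e₁) = D(i,j) + e^{iβ_j} - e^{iα_{i-1}}` (`= D(i-1, j+1)`). [cite: GrimmettManolescu2014Isoradial, §4.6] -/
theorem gmVertex_add_single_one (x : Site 2) :
    gmVertex α β (x + Pi.single 1 1) =
      gmVertex α β x + cexp ((β (x 0 + x 1) : ℂ) * I) - cexp ((α (x 0 - x 1 - 1) : ℂ) * I) := by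
  simp only [gmVertex, Pi.add_apply, Pi.single_eq_same,
    Pi.single_eq_of_ne (zero_ne_one : (0 : Fin 2) ≠ 1)]
  have h1 := gmDiamond_add_one_left α β (x 0 - x 1 - 1) (x 0 + x 1 + 1)
  rw [sub_add_cancel, gmDiamond_add_one_right] at h1
  rw [show x 0 + 0 - (x 1 + 1) = x 0 - x 1 - 1 by ring, show x 0 + 0 + (x 1 + 1) = x 0 + x 1 + 1 by ring]
  linear_combination -h1

/-- `c(x) = D(i,j) + e^{iβ_j}` (`= D(i, j+1)`). [cite: GrimmettManolescu2014Isoradial, §4.6] -/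
theorem gmFace_self (x : Site 2) :
    gmFace α β x = gmVertex α β x + cexp ((β (x 0 + x 1) : ℂ) * I) := by
  rw [gmFace, gmVertex, gmDiamond_add_one_right]

/-- `c(x - e₁) = D(i,j) + e^{iα_i}` (`= D(i+1, j)`). [cite: GrimmettManolescu2014Isoradial, §4.6] -/
theorem gmFace_sub_single_one (x : Site 2) :
    gmFace α β (x - Pi.single 1 1) = gmVertex α β x + cexp ((α (x 0 - x 1) : ℂ) * I) := by
  simp only [gmFace, gmVertex, Pi.sub_apply, Pi.single_eq_same,
    Pi.single_eq_of_ne (zero_ne_one : (0 : Fin 2) ≠ 1)]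
  rw [show x 0 - 0 - (x 1 - 1) = x 0 - x 1 + 1 by ring, show x 0 - 0 + (x 1 - 1) + 1 = x 0 + x 1 by ring,
    gmDiamond_add_one_left]

/-- `c(x - e₀) = D(i,j) - e^{iα_{i-1}}` (`= D(i-1, j)`). [cite: GrimmettManolescu2014Isoradial, §4.6] -/
theorem gmFace_sub_single_zero (x : Site 2) :
    gmFace α β (x - Pi.single 0 1) = gmVertex α β x - cexp ((α (x 0 - x 1 - 1) : ℂ) * I) := by
  simp only [gmFace, gmVertex, Pi.sub_apply, Pi.single_eq_same,
    Pi.single_eq_of_ne (one_ne_zero : (1 : Fin 2) ≠ 0)]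
  have h1 := gmDiamond_add_one_left α β (x 0 - x 1 - 1) (x 0 + x 1)
  rw [sub_add_cancel] at h1
  rw [show x 0 - 1 - (x 1 - 0) = x 0 - x 1 - 1 by ring, show x 0 - 1 + (x 1 - 0) + 1 = x 0 + x 1 by ring]
  linear_combination -h1

end Unfold

/-! ### The rhombus of a dart -/

/-- The **rhombus angle at the tail** of the dart `d = (v_{i,j} → ·)` of `G_{α,β}`: `β_j - α_i`
for the step to `v_{i+1,j+1}` (east in `ℤ²`), `π - (β_j - α_{i-1})` to `v_{i-1,j+1}` (north),
`β_{j-1} - α_{i-1}` to `v_{i-1,j-1}` (west), `π - (β_{j-1} - α_i)` to `v_{i+1,j-1}` (south): "tracks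
`t_i, s_j` intersect in a rhombus of `G^◇` with sides `τ(t_i), τ(s_j), -τ(t_i), -τ(s_j)` in
clockwise order, and thus its internal angles are `β_j - α_i` and `π - (β_j - α_i)`".
[cite: GrimmettManolescu2014Isoradial, §4.6 (before (4.5))] -/
def gmDartAngle (α β : ℤ → ℝ) (d : (zdGraph 2).Dart) : ℝ :=
  if d.snd = d.fst + Pi.single 0 1 then β (d.fst 0 + d.fst 1) - α (d.fst 0 - d.fst 1)
  else if d.snd = d.fst + Pi.single 1 1 then π - (β (d.fst 0 + d.fst 1) - α (d.fst 0 - d.fst 1 - 1))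
  else if d.fst = d.snd + Pi.single 0 1 then β (d.fst 0 + d.fst 1 - 1) - α (d.fst 0 - d.fst 1 - 1)
  else π - (β (d.fst 0 + d.fst 1 - 1) - α (d.fst 0 - d.fst 1))

/-- The **direction of the right side at the tail** of a dart of `G_{α,β}` (the argument of
`c (rightFace d) - z (d.fst)`): `α_i`, `β_j`, `α_{i-1} + π`, `β_{j-1} + π` for the east, north,
west, south darts at `v_{i,j}`. [cite: GrimmettManolescu2014Isoradial, §4.6] -/
def gmDartBase (α β : ℤ → ℝ) (d : (zdGraph 2).Dart) : ℝ :=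
  if d.snd = d.fst + Pi.single 0 1 then α (d.fst 0 - d.fst 1)
  else if d.snd = d.fst + Pi.single 1 1 then β (d.fst 0 + d.fst 1)
  else if d.fst = d.snd + Pi.single 0 1 then α (d.fst 0 - d.fst 1 - 1) + π
  else β (d.fst 0 + d.fst 1 - 1) + π

section DartCases

variable (α β : ℤ → ℝ)

/-- `y ≠ y + 2e₀`. [folklore] -/
private theorem ne_add_zero_zero (y : Site 2) : y ≠ y + Pi.single 0 1 + Pi.single 0 1 := by
  intro h; have := congrFun h 0; simp at this; omega

/-- `y ≠ y + e₀ + e₁`. [folklore] -/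
private theorem ne_add_zero_one (y : Site 2) : y ≠ y + Pi.single 0 1 + Pi.single 1 1 := by
  intro h; have := congrFun h 0; simp at this

/-- `y ≠ y + e₁ + e₀`. [folklore] -/
private theorem ne_add_one_zero (y : Site 2) : y ≠ y + Pi.single 1 1 + Pi.single 0 1 := by
  intro h; have := congrFun h 1; simp at this

/-- `y ≠ y + 2e₁`. [folklore] -/
private theorem ne_add_one_one (y : Site 2) : y ≠ y + Pi.single 1 1 + Pi.single 1 1 := by
  intro h; have := congrFun h 1; simp at this; omega

/-- `y + e₁ ≠ y + e₀`. [folklore] -/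
private theorem add_one_ne_add_zero (y : Site 2) : y + Pi.single 1 1 ≠ y + Pi.single 0 1 := by
  intro h; exact single_zero_ne_single_one (add_left_cancel h).symm

variable {α β}

/-- East dart: angle `β_j - α_i`, base `α_i`. [cite: GrimmettManolescu2014Isoradial, §4.6] -/
theorem gmDart_east {d : (zdGraph 2).Dart} (h : d.snd = d.fst + Pi.single 0 1) :
    gmDartAngle α β d = β (d.fst 0 + d.fst 1) - α (d.fst 0 - d.fst 1) ∧
      gmDartBase α β d = α (d.fst 0 - d.fst 1) := by
  simp only [gmDartAngle, gmDartBase, h, if_true, and_self]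

/-- North dart: angle `π - (β_j - α_{i-1})`, base `β_j`. [cite: GrimmettManolescu2014Isoradial, §4.6] -/
theorem gmDart_north {d : (zdGraph 2).Dart} (h : d.snd = d.fst + Pi.single 1 1) :
    gmDartAngle α β d = π - (β (d.fst 0 + d.fst 1) - α (d.fst 0 - d.fst 1 - 1)) ∧
      gmDartBase α β d = β (d.fst 0 + d.fst 1) := by
  simp only [gmDartAngle, gmDartBase, h, add_one_ne_add_zero, if_false, if_true, and_self]

/-- West dart (`d.fst = d.snd + e₀`): in the indices `i', j'` of the head, angle `β_{j'} - α_{i'}`,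
base `α_{i'} + π`. [cite: GrimmettManolescu2014Isoradial, §4.6] -/
theorem gmDart_west {d : (zdGraph 2).Dart} (h : d.fst = d.snd + Pi.single 0 1) :
    gmDartAngle α β d = β (d.snd 0 + d.snd 1) - α (d.snd 0 - d.snd 1) ∧
      gmDartBase α β d = α (d.snd 0 - d.snd 1) + π := by
  simp only [gmDartAngle, gmDartBase, h, ne_add_zero_zero, ne_add_zero_one, if_false, if_true,
    Pi.add_apply, Pi.single_eq_same, Pi.single_eq_of_ne (one_ne_zero : (1 : Fin 2) ≠ 0)]
  constructor <;> ring_nf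

/-- South dart (`d.fst = d.snd + e₁`): in the indices `i', j'` of the head, angle
`π - (β_{j'} - α_{i'-1})`, base `β_{j'} + π`. [cite: GrimmettManolescu2014Isoradial, §4.6] -/
theorem gmDart_south {d : (zdGraph 2).Dart} (h : d.fst = d.snd + Pi.single 1 1) :
    gmDartAngle α β d = π - (β (d.snd 0 + d.snd 1) - α (d.snd 0 - d.snd 1 - 1)) ∧
      gmDartBase α β d = β (d.snd 0 + d.snd 1) + π := by
  simp only [gmDartAngle, gmDartBase, h, ne_add_one_zero, ne_add_one_one, add_one_ne_add_zero,
    if_false, Pi.add_apply, Pi.single_eq_same, Pi.single_eq_of_ne (zero_ne_one : (0 : Fin 2) ≠ 1)]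
  constructor <;> ring_nf

variable (α β)

/-- Every dart angle of `G_{α,β}` is one of the rhombus angles `β_j - α_i` or `π - (β_j - α_i)`.
[cite: GrimmettManolescu2014Isoradial, §4.6] -/
theorem gmDartAngle_cases (d : (zdGraph 2).Dart) :
    ∃ i j, gmDartAngle α β d = β j - α i ∨ gmDartAngle α β d = π - (β j - α i) := by
  unfold gmDartAngle
  split_ifs
  · exact ⟨_, _, Or.inl rfl⟩
  · exact ⟨_, _, Or.inr rfl⟩
  · exact ⟨_, _, Or.inl rfl⟩
  · exact ⟨_, _, Or.inr rfl⟩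

/-- `e^{i(θ + π)} = -e^{iθ}`. [folklore] -/
theorem exp_add_pi_mul_I (θ : ℝ) : cexp (((θ + π : ℝ) : ℂ) * I) = -cexp ((θ : ℂ) * I) := by
  push_cast
  rw [add_mul, Complex.exp_add, Complex.exp_pi_mul_I]
  ring

/-- `e^{i(θ + 2π)} = e^{iθ}`. [folklore] -/
theorem exp_add_two_pi_mul_I (θ : ℝ) : cexp (((θ + 2 * π : ℝ) : ℂ) * I) = cexp ((θ : ℂ) * I) := by
  push_cast
  rw [add_mul, Complex.exp_add, Complex.exp_two_pi_mul_I, mul_one]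

/-- **The rhombus of a dart of `G_{α,β}` in coordinates.** For every dart `d = (x → y)`, with
`φ = gmDartBase d` and `Θ = gmDartAngle d`: `c (rightFace d) - z x = e^{iφ}`,
`c (leftFace d) - z x = e^{i(φ + Θ)}` and `z y - z x = e^{iφ} + e^{i(φ + Θ)}` — the rhombus of `d`
has unit sides in the directions `φ` (right) and `φ + Θ` (left) at its tail, i.e. angle `Θ`
there. [cite: GrimmettManolescu2014Isoradial, §4.6 (Figure 4.4)] -/
theorem gm_dart_geometry (d : (zdGraph 2).Dart) :
    (gmEmbedding α β).c ((gmEmbedding α β).rightFace d) - (gmEmbedding α β).z d.fst =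
        cexp ((gmDartBase α β d : ℂ) * I) ∧
      (gmEmbedding α β).c ((gmEmbedding α β).leftFace d) - (gmEmbedding α β).z d.fst =
        cexp (((gmDartBase α β d + gmDartAngle α β d : ℝ) : ℂ) * I) ∧
      (gmEmbedding α β).z d.snd - (gmEmbedding α β).z d.fst =
        cexp ((gmDartBase α β d : ℂ) * I) + cexp (((gmDartBase α β d + gmDartAngle α β d : ℝ) : ℂ) * I) := by
  simp only [gmEmbedding_z, gmEmbedding_c, gmEmbedding_leftFace, gmEmbedding_rightFace]
  rcases zdGraph_two_dart_cases d with h | h | h | h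
  · -- east
    obtain ⟨hA, hB⟩ := gmDart_east (α := α) (β := β) h
    rw [hA, hB, h, squareLeftFace_east, squareLeftFace_west, gmFace_sub_single_one, gmFace_self,
      gmVertex_add_single_zero,
      show α (d.fst 0 - d.fst 1) + (β (d.fst 0 + d.fst 1) - α (d.fst 0 - d.fst 1)) = β (d.fst 0 + d.fst 1) by ring]
    refine ⟨by ring, by ring, by ring⟩
  · -- north
    obtain ⟨hA, hB⟩ := gmDart_north (α := α) (β := β) h
    rw [hA, hB, h, squareLeftFace_north, squareLeftFace_south, gmFace_sub_single_zero, gmFace_self,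
      gmVertex_add_single_one,
      show β (d.fst 0 + d.fst 1) + (π - (β (d.fst 0 + d.fst 1) - α (d.fst 0 - d.fst 1 - 1))) =
        α (d.fst 0 - d.fst 1 - 1) + π by ring,
      exp_add_pi_mul_I]
    refine ⟨by ring, by ring, by ring⟩
  · -- west
    obtain ⟨hA, hB⟩ := gmDart_west (α := α) (β := β) h
    rw [hA, hB, h, squareLeftFace_west, squareLeftFace_east, gmFace_sub_single_one, gmFace_self,
      gmVertex_add_single_zero,
      show α (d.snd 0 - d.snd 1) + π + (β (d.snd 0 + d.snd 1) - α (d.snd 0 - d.snd 1)) =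
        β (d.snd 0 + d.snd 1) + π by ring,
      exp_add_pi_mul_I, exp_add_pi_mul_I]
    refine ⟨by ring, by ring, by ring⟩
  · -- south
    obtain ⟨hA, hB⟩ := gmDart_south (α := α) (β := β) h
    rw [hA, hB, h, squareLeftFace_south, squareLeftFace_north, gmFace_sub_single_zero, gmFace_self,
      gmVertex_add_single_one,
      show β (d.snd 0 + d.snd 1) + π + (π - (β (d.snd 0 + d.snd 1) - α (d.snd 0 - d.snd 1 - 1))) =
        α (d.snd 0 - d.snd 1 - 1) + 2 * π by ring,
      exp_add_pi_mul_I, exp_add_two_pi_mul_I]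
    refine ⟨by ring, by ring, by ring⟩

end DartCases

/-! ### Isoradiality, half-angles and the bounded-angles property -/

section Isoradial

variable {α β : ℤ → ℝ}

/-- The change of coordinates `(x, y) ↦ (i, j) = (x - y, x + y)` is injective. [folklore] -/
theorem site_eq_of_diff_eq_of_sum_eq {x y : Site 2} (h₁ : x 0 - x 1 = y 0 - y 1)
    (h₂ : x 0 + x 1 = y 0 + y 1) : x = y := by
  funext k
  fin_cases k
  · change x 0 = y 0; omega
  · change x 1 = y 1; omega

/-- **The vertices of `G_{α,β}` are pairwise distinct** under (4.5). [cite: GrimmettManolescu2014Isoradial, §4.6 with (4.5)] -/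
theorem gmVertex_injective (h : ∀ i j, 0 < Real.sin (β j - α i)) :
    Function.Injective (gmVertex α β) := by
  intro x y hxy
  have := gmDiamond_injective h (a₁ := (x 0 - x 1, x 0 + x 1)) (a₂ := (y 0 - y 1, y 0 + y 1)) hxy
  simp only [Prod.mk.injEq] at this
  exact site_eq_of_diff_eq_of_sum_eq this.1 this.2

/-- **The face centres of `G_{α,β}` are pairwise distinct** under (4.5). [cite: GrimmettManolescu2014Isoradial, §4.6 with (4.5)] -/
theorem gmFace_injective (h : ∀ i j, 0 < Real.sin (β j - α i)) :
    Function.Injective (gmFace α β) := by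
  intro x y hxy
  have := gmDiamond_injective h (a₁ := (x 0 - x 1, x 0 + x 1 + 1)) (a₂ := (y 0 - y 1, y 0 + y 1 + 1)) hxy
  simp only [Prod.mk.injEq, add_left_inj] at this
  exact site_eq_of_diff_eq_of_sum_eq this.1 this.2

/-- Under (4.5) every dart angle lies in `(0, π)`. [cite: GrimmettManolescu2014Isoradial, §4.6] -/
theorem gmDartAngle_mem_Ioo (h : ∀ i j, 0 < β j - α i ∧ β j - α i < π) (d : (zdGraph 2).Dart) :
    gmDartAngle α β d ∈ Set.Ioo 0 π := by
  obtain ⟨i, j, hd | hd⟩ := gmDartAngle_cases α β d <;> rw [hd]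
  · exact h i j
  · constructor <;> linarith [(h i j).1, (h i j).2]

/-- **`G_{α,β}` is an isoradial embedding of `ℤ²`** as soon as `β_j - α_i ∈ (0, π)` for all
`i, j` ((4.5) with `ε > 0`): corner–centre distances are `1` (unit rhombus sides), reversing a
dart swaps its faces, the two face centres of a rhombus differ (`e^{iΘ} ≠ 1` for `Θ ∈ (0, π)`),
and the vertex positions are distinct (`gmVertex_injective`). [cite: GrimmettManolescu2014Isoradial, §4.6 ("This gives rise to an isoradial square lattice denoted G_{α,β}")] -/
theorem isIsoradial_gmEmbedding (h : ∀ i j, 0 < β j - α i ∧ β j - α i < π) :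
    (gmEmbedding α β).IsIsoradial := by
  refine ⟨fun d => ?_, fun d => rfl, fun d => ?_, ?_⟩
  · obtain ⟨-, h2, h3⟩ := gm_dart_geometry α β d
    constructor
    · rw [← norm_neg, neg_sub, h2, Complex.norm_exp_ofReal_mul_I]
    · have : (gmEmbedding α β).z d.snd - (gmEmbedding α β).c ((gmEmbedding α β).leftFace d) =
          cexp ((gmDartBase α β d : ℂ) * I) := by
        linear_combination h3 - h2
      rw [this, Complex.norm_exp_ofReal_mul_I]
  · obtain ⟨h1, h2, -⟩ := gm_dart_geometry α β d
    intro heq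
    have hΘ := gmDartAngle_mem_Ioo h d
    have hsin : 0 < Real.sin (gmDartAngle α β d) := Real.sin_pos_of_pos_of_lt_pi hΘ.1 hΘ.2
    have hexp : cexp ((gmDartAngle α β d : ℂ) * I) = 1 := by
      have h0 : cexp ((gmDartBase α β d : ℂ) * I) ≠ 0 := Complex.exp_ne_zero _
      have : cexp (((gmDartBase α β d + gmDartAngle α β d : ℝ) : ℂ) * I) =
          cexp ((gmDartBase α β d : ℂ) * I) := by rw [← h1, ← h2, heq]
      rw [Complex.ofReal_add, add_mul, Complex.exp_add] at this
      exact (mul_eq_left₀ h0).1 this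
    have := congrArg Complex.im hexp
    rw [Complex.exp_ofReal_mul_I_im, Complex.one_im] at this
    linarith
  · exact gmVertex_injective fun i j => Real.sin_pos_of_pos_of_lt_pi (h i j).1 (h i j).2

/-- `e^{iΘ} / (1 + e^{iΘ}) = (2 cos (Θ/2))⁻¹ (cos (Θ/2) + i sin (Θ/2))` for `Θ ∈ (0, π)`. [folklore] -/
theorem exp_div_one_add_exp {Θ : ℝ} (hΘ : Θ ∈ Set.Ioo 0 π) :
    cexp ((Θ : ℂ) * I) / (1 + cexp ((Θ : ℂ) * I)) =
      (((2 * Real.cos (Θ / 2))⁻¹ : ℝ) : ℂ) *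
        (Complex.cos ((Θ / 2 : ℝ) : ℂ) + Complex.sin ((Θ / 2 : ℝ) : ℂ) * I) := by
  have hc : 0 < Real.cos (Θ / 2) :=
    Real.cos_pos_of_mem_Ioo ⟨by linarith [hΘ.1, Real.pi_pos], by linarith [hΘ.2]⟩
  have hc' : (Complex.cos ((Θ / 2 : ℝ) : ℂ)) ≠ 0 := by
    rw [← Complex.ofReal_cos]; exact_mod_cast hc.ne'
  have hH : cexp (((Θ / 2 : ℝ) : ℂ) * I) ≠ 0 := Complex.exp_ne_zero _
  rw [← Complex.exp_mul_I, one_add_exp_mul_I, div_eq_iff (mul_ne_zero (mul_ne_zero two_ne_zero hc') hH)]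
  have hsq : cexp ((Θ : ℂ) * I) = cexp (((Θ / 2 : ℝ) : ℂ) * I) * cexp (((Θ / 2 : ℝ) : ℂ) * I) := by
    rw [← Complex.exp_add]; congr 1; push_cast; ring
  rw [hsq, ← Complex.ofReal_cos]
  push_cast at hc' ⊢
  field_simp

/-- **The rhombus half-angles of `G_{α,β}`**: under (4.5), `halfAngle d = Θ_d / 2` where
`Θ_d = gmDartAngle d` is the rhombus angle at the tail (`β_j - α_i` or `π - (β_j - α_i)`).
[cite: GrimmettManolescu2014Isoradial, §4.6 ("its internal angles are β_j - α_i and π - (β_j - α_i)")] -/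
theorem halfAngle_gmEmbedding (h : ∀ i j, 0 < β j - α i ∧ β j - α i < π) (d : (zdGraph 2).Dart) :
    (gmEmbedding α β).halfAngle d = gmDartAngle α β d / 2 := by
  obtain ⟨-, h2, h3⟩ := gm_dart_geometry α β d
  have hΘ := gmDartAngle_mem_Ioo h d
  set φ := gmDartBase α β d
  set Θ := gmDartAngle α β d
  have hE : cexp ((φ : ℂ) * I) ≠ 0 := Complex.exp_ne_zero _
  have hq : ((gmEmbedding α β).c ((gmEmbedding α β).leftFace d) - (gmEmbedding α β).z d.fst) /
      ((gmEmbedding α β).z d.snd - (gmEmbedding α β).z d.fst) =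
        cexp ((Θ : ℂ) * I) / (1 + cexp ((Θ : ℂ) * I)) := by
    rw [h2, h3, Complex.ofReal_add, add_mul, Complex.exp_add, ← mul_one_add, mul_div_mul_left _ _ hE]
  have hc : 0 < Real.cos (Θ / 2) :=
    Real.cos_pos_of_mem_Ioo ⟨by linarith [hΘ.1, Real.pi_pos], by linarith [hΘ.2]⟩
  unfold RhombicEmbedding.halfAngle
  rw [hq, exp_div_one_add_exp hΘ, Complex.arg_real_mul _ (by positivity),
    Complex.arg_cos_add_sin_mul_I ⟨by linarith [hΘ.1, Real.pi_pos], by linarith [hΘ.2, Real.pi_pos]⟩]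
  exact abs_of_pos (by linarith [hΘ.1])

/-- **`G_{α,β}` satisfies BAP(`ε`) when `β_j - α_i ∈ [2ε, π - 2ε]`** (the paper's (4.5),
"`β_j - α_i ∈ [ε, π - ε]`", written in the half-angle units of `HasBoundedAngles`: the tree's
BAP(`ε`) bounds the half-angles by `[ε, π/2 - ε]`, i.e. the rhombus angles by `[2ε, π - 2ε]`).
[cite: GrimmettManolescu2014Isoradial, §4.6 (4.5) ("G satisfies BAP(ε) if and only if β_j - α_i ∈ [ε, π-ε]")] -/
theorem hasBoundedAngles_gmEmbedding {ε : ℝ} (hε : 0 < ε)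
    (h : ∀ i j, 2 * ε ≤ β j - α i ∧ β j - α i ≤ π - 2 * ε) :
    (gmEmbedding α β).HasBoundedAngles ε := by
  have h' : ∀ i j, 0 < β j - α i ∧ β j - α i < π := fun i j =>
    ⟨by linarith [(h i j).1], by linarith [(h i j).2]⟩
  intro d
  rw [halfAngle_gmEmbedding h' d]
  obtain ⟨i, j, hd | hd⟩ := gmDartAngle_cases α β d <;> rw [hd] <;>
    constructor <;> linarith [(h i j).1, (h i j).2]

/-- **Conversely, BAP(`ε`) for `G_{α,β}` forces `β_j - α_i ∈ [2ε, π - 2ε]`** (given (4.5)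
qualitatively): the angle `β_j - α_i` is the tail angle of the east dart at `v_{i,j}` when `i + j`
is even, and `π` minus the tail angle of the north dart at `v_{i+1,j}` when `i + j` is odd.
[cite: GrimmettManolescu2014Isoradial, §4.6 (4.5) (the "only if")] -/
theorem angle_bounds_of_hasBoundedAngles (h : ∀ i j, 0 < β j - α i ∧ β j - α i < π) {ε : ℝ}
    (hb : (gmEmbedding α β).HasBoundedAngles ε) (i j : ℤ) :
    2 * ε ≤ β j - α i ∧ β j - α i ≤ π - 2 * ε := by
  rcases Int.even_or_odd (i + j) with ⟨k, hk⟩ | ⟨k, hk⟩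
  · -- `v_{i,j}` is the site `x = (k, k - i)`... with `x₀ - x₁ = i`, `x₀ + x₁ = j`: `x = ((i+j)/2, (j-i)/2)`
    set x : Site 2 := ![k, k - i] with hx
    have hadj : (zdGraph 2).Adj x (x + Pi.single 0 1) := (zdGraph_adj_iff _ _).2 ⟨0, Or.inl rfl⟩
    have hA := (gmDart_east (α := α) (β := β) (d := ⟨(x, x + Pi.single 0 1), hadj⟩) rfl).1
    have hb' := hb ⟨(x, x + Pi.single 0 1), hadj⟩
    rw [halfAngle_gmEmbedding h, hA] at hb'
    have e0 : x 0 = k := rfl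
    have e1 : x 1 = k - i := rfl
    simp only [e0, e1, show k + (k - i) = j by omega, show k - (k - i) = i by omega] at hb'
    constructor <;> linarith [hb'.1, hb'.2]
  · -- `i + j = 2k + 1`: north dart at the site with `x₀ - x₁ = i + 1`, `x₀ + x₁ = j`
    set x : Site 2 := ![k + 1, k - i] with hx
    have hadj : (zdGraph 2).Adj x (x + Pi.single 1 1) := (zdGraph_adj_iff _ _).2 ⟨1, Or.inl rfl⟩
    have hA := (gmDart_north (α := α) (β := β) (d := ⟨(x, x + Pi.single 1 1), hadj⟩) rfl).1
    have hb' := hb ⟨(x, x + Pi.single 1 1), hadj⟩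
    rw [halfAngle_gmEmbedding h, hA] at hb'
    have e0 : x 0 = k + 1 := rfl
    have e1 : x 1 = k - i := rfl
    simp only [e0, e1, show k + 1 + (k - i) = j by omega, show k + 1 - (k - i) - 1 = i by omega] at hb'
    constructor <;> linarith [hb'.1, hb'.2]

/-- **(4.5) ⟺ BAP(`ε`)** for `G_{α,β}`, `ε > 0`, given the angles `β_j - α_i ∈ (0, π)`.
[cite: GrimmettManolescu2014Isoradial, §4.6 (4.5) ("Thus, G satisfies BAP(ε) if and only if β_j - α_i ∈ [ε, π - ε], i, j ∈ ℤ")] -/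
theorem hasBoundedAngles_gmEmbedding_iff (h : ∀ i j, 0 < β j - α i ∧ β j - α i < π) {ε : ℝ}
    (hε : 0 < ε) :
    (gmEmbedding α β).HasBoundedAngles ε ↔ ∀ i j, 2 * ε ≤ β j - α i ∧ β j - α i ≤ π - 2 * ε :=
  ⟨fun hb i j => angle_bounds_of_hasBoundedAngles h hb i j, hasBoundedAngles_gmEmbedding hε⟩

end Isoradial

/-! ### The canonical measure `P_{α,β}` -/

/-- The index `i` of the vertical track `t_i` crossed by an edge of `ℤ²`, in the coordinates
`i = x - y`: the edge `{a, b}` joins diamond columns `a₀ - a₁` and `b₀ - b₁`, and the rhombus it is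
a diagonal of lies in the track `t_i`, `i = min (a₀ - a₁, b₀ - b₁)` (for the vertical edge
`(x,y)–(x,y+1)` this is `x - y - 1`, for the horizontal edge `(x,y)–(x+1,y)` it is `x - y`).
[cite: GrimmettManolescu2014Isoradial, §4.6] -/
def columnIndex : Sym2 (Site 2) → ℤ :=
  Sym2.lift ⟨fun a b => min (a 0 - a 1) (b 0 - b 1), fun _ _ => min_comm _ _⟩

/-- `columnIndex` on an explicit pair. [folklore] -/
@[simp] theorem columnIndex_mk (a b : Site 2) : columnIndex s(a, b) = min (a 0 - a 1) (b 0 - b 1) := rfl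

/-- The horizontal edge `(x, y) → (x+1, y)` lies in the track `t_{x-y}`. [cite: GrimmettManolescu2014Isoradial, §4.6] -/
theorem columnIndex_horizontal (x : Site 2) : columnIndex s(x, x + Pi.single 0 1) = x 0 - x 1 := by
  rw [columnIndex_mk]
  simp only [Pi.add_apply, Pi.single_eq_same, Pi.single_eq_of_ne (one_ne_zero : (1 : Fin 2) ≠ 0)]
  exact min_eq_left (by omega)

/-- The vertical edge `(x, y) → (x, y+1)` lies in the track `t_{x-y-1}`. [cite: GrimmettManolescu2014Isoradial, §4.6] -/
theorem columnIndex_vertical (x : Site 2) : columnIndex s(x, x + Pi.single 1 1) = x 0 - x 1 - 1 := by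
  rw [columnIndex_mk]
  simp only [Pi.add_apply, Pi.single_eq_same, Pi.single_eq_of_ne (zero_ne_one : (0 : Fin 2) ≠ 1)]
  rw [min_eq_right (by omega)]
  ring

open scoped Classical in
/-- **The canonical edge weights of `G_{α,β}`** (`P_{α,β}` is the product measure with these
intensities): the horizontal edge of `ℤ²` in the rhombus `t_i ∩ s_j` (a diagonal from a corner of
angle `β_j - α_i`) gets `p_{β_j - α_i} = criticalWeightI ((β_j - α_i)/2)`, the vertical edge in
`t_i ∩ s_j` (a diagonal from a corner of angle `π - (β_j - α_i)`) gets
`p_{π - (β_j - α_i)} = criticalWeightI ((π - (β_j - α_i))/2)`; non-edges get `0`. Here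
`i = columnIndex e`, `j = trackIndex e`; `p_θ` is the canonical weight (2.2) of an edge whose
rhombus has angle `θ` at its endpoints, cf. `η_k(n) = p_{π-β̄+α_n} p_{π-β_k+β̄} / (p_{β̄-α_n} p_{β_k-β̄})`
in the proof of Lemma 6.6. For `α ≡ 0` these are DKKMO's `mixedWeight β` (`gmWeight_zero_left`).
[cite: GrimmettManolescu2014Isoradial, §4.6 (P_{α,β}) with §2.2 (2.2)] -/
def gmWeight (α β : ℤ → ℝ) (e : Sym2 (Site 2)) : unitInterval :=
  if e ∈ (zdGraph 2).edgeSet then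
    (if IsHorizontal e then criticalWeightI ((β (trackIndex e) - α (columnIndex e)) / 2)
      else criticalWeightI ((π - (β (trackIndex e) - α (columnIndex e))) / 2))
  else 0

section Weights

variable {α β : ℤ → ℝ}

/-- For every dart `d`, the recipe of `gmWeight` on `d.edge` returns the half tail angle of `d`
(both darts over an edge have the same tail angle: opposite corners of a rhombus).
[cite: GrimmettManolescu2014Isoradial, §4.6] -/
theorem gmWeight_edge (d : (zdGraph 2).Dart) :
    gmWeight α β d.edge = criticalWeightI (gmDartAngle α β d / 2) := by
  classical
  have he := d.edge_mem
  rcases zdGraph_two_dart_cases d with h | h | h | h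
  · have hedge : d.edge = s(d.fst, d.fst + Pi.single 0 1) := by rw [← h]; rfl
    rw [hedge] at he ⊢
    unfold gmWeight
    rw [(gmDart_east h).1, if_pos he, if_pos (by rw [isHorizontal_mk]; simp), trackIndex_horizontal,
      columnIndex_horizontal]
  · have hedge : d.edge = s(d.fst, d.fst + Pi.single 1 1) := by rw [← h]; rfl
    rw [hedge] at he ⊢
    unfold gmWeight
    rw [(gmDart_north h).1, if_pos he, if_neg (by rw [isHorizontal_mk]; simp), trackIndex_vertical,
      columnIndex_vertical]
  · have hedge : d.edge = s(d.snd, d.snd + Pi.single 0 1) := by rw [Sym2.eq_swap, ← h]; rfl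
    rw [hedge] at he ⊢
    unfold gmWeight
    rw [(gmDart_west h).1, if_pos he, if_pos (by rw [isHorizontal_mk]; simp), trackIndex_horizontal,
      columnIndex_horizontal]
  · have hedge : d.edge = s(d.snd, d.snd + Pi.single 1 1) := by rw [Sym2.eq_swap, ← h]; rfl
    rw [hedge] at he ⊢
    unfold gmWeight
    rw [(gmDart_south h).1, if_pos he, if_neg (by rw [isHorizontal_mk]; simp), trackIndex_vertical,
      columnIndex_vertical]

/-- **The canonical edge weights of the isoradial embedding `G_{α,β}` are `gmWeight α β`**:
`edgeWeight e = criticalWeightI (halfAngle e)` with `halfAngle = Θ/2` (either dart over `e`).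
[cite: GrimmettManolescu2014Isoradial, §4.6 with §2.2 (2.2)] -/
theorem edgeWeight_gmEmbedding (h : ∀ i j, 0 < β j - α i ∧ β j - α i < π) :
    (gmEmbedding α β).edgeWeight = gmWeight α β := by
  classical
  funext e
  unfold RhombicEmbedding.edgeWeight
  by_cases he : e ∈ (zdGraph 2).edgeSet
  · have hrhs : gmWeight α β e = gmWeight α β (refDart ⟨e, he⟩).edge := by rw [refDart_edge]
    rw [dif_pos he, hrhs, gmWeight_edge, halfAngle_gmEmbedding h]
  · unfold gmWeight
    rw [dif_neg he, if_neg he]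

/-- **The canonical measure of `G_{α,β}` is the product measure `P_{α,β}` with intensities
`gmWeight α β`.** [cite: GrimmettManolescu2014Isoradial, §4.6 ("We write P_{α,β} for the canonical measure of G_{α,β}")] -/
theorem isoradialPercolation_gmEmbedding (h : ∀ i j, 0 < β j - α i ∧ β j - α i < π) :
    (gmEmbedding α β).isoradialPercolation = prodBernoulli (gmWeight α β) := by
  rw [RhombicEmbedding.isoradialPercolation, edgeWeight_gmEmbedding h]


end Weights

/-! ### Tracks, square grid, connectivity -/

/-- `G_{α,β}` and the tree's `squareLatticeEmbedding` have the same rhombus sides and the same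
opposite-side maps (they share the face bookkeeping `squareLeftFace`), so the identity is a
side-compatible edge bijection between them. [folklore] -/
theorem isSideCompatible_squareLattice_gmEmbedding (α β : ℤ → ℝ) :
    RhombicEmbedding.IsSideCompatible squareLatticeEmbedding (gmEmbedding α β) (Equiv.refl _) id where
  injective := Function.injective_id
  sides_eq e := by rw [Finset.image_id]; rfl
  oppositeSide_eq e p _ := rfl

/-- **`G_{α,β}` satisfies SGP(1)**: its track system is the square grid of `ℤ²` — the track
predicates of a rhombic embedding only involve the face bookkeeping (`sides`, `oppositeSide`),
which `G_{α,β}` shares with `squareLatticeEmbedding`. ("Isoradial square lattices, and only these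
graphs, have a square grid as track-system"; "The track-system of such a graph is simply a square
grid".) [cite: GrimmettManolescu2014Isoradial, §4.3.1 and §4.6] -/
theorem squareGridPropertyGM_gmEmbedding (α β : ℤ → ℝ) : (gmEmbedding α β).SquareGridPropertyGM 1 :=
  (isSideCompatible_squareLattice_gmEmbedding α β).squareGridPropertyGM squareGridPropertyGM_squareLattice

/-- `G_{α,β}` has the printed square-grid property SGP. [cite: GrimmettManolescu2014Isoradial, §4.6] -/
theorem hasSquareGridPropertyGM_gmEmbedding (α β : ℤ → ℝ) : (gmEmbedding α β).HasSquareGridPropertyGM :=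
  (squareGridPropertyGM_gmEmbedding α β).hasSquareGridPropertyGM

/-! ### Special cases: DKKMO's `𝕃(𝛃)` and the square lattice -/

/-- **For `α ≡ 0`, `G_{0,β}` is DKKMO's lattice `𝕃(𝛃)`** (vertical tracks of transverse angle
`0`, unit mesh): `gmVertex 0 β = mixedPoint 1 β`. [cite: arXiv201211672v2, §2.1] -/
theorem gmVertex_zero_left (β : ℤ → ℝ) (x : Site 2) :
    gmVertex (fun _ => 0) β x = mixedPoint 1 β x := by
  simp [gmVertex, gmDiamond, mixedPoint, trackHeight_const]

/-- For `α ≡ 0` the weights of `G_{0,β}` are DKKMO's `mixedWeight β`. [cite: arXiv201211672v2, §2.2] -/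
theorem gmWeight_zero_left (β : ℤ → ℝ) : gmWeight (fun _ => 0) β = mixedWeight β := by
  funext e
  unfold gmWeight mixedWeight
  simp only [sub_zero]

/-- **The canonical measure of `G_{0,β}` is `φ_{𝕃(𝛃)}` at `q = 1`** (`mixedPercolation β`), for
angles `β_j ∈ (0, π)`. [cite: arXiv201211672v2, §2.2] -/
theorem isoradialPercolation_gmEmbedding_zero_left {β : ℤ → ℝ} (hβ : ∀ j, 0 < β j ∧ β j < π) :
    (gmEmbedding (fun _ => 0) β).isoradialPercolation = mixedPercolation β := by
  rw [isoradialPercolation_gmEmbedding (fun _ j => by simpa using hβ j), gmWeight_zero_left,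
    mixedPercolation]

/-- `e^{iπ/4} = (√2/2)(1 + i)` and `e^{-iπ/4} = (√2/2)(1 - i)`. [folklore] -/
theorem exp_pi_div_four_mul_I :
    cexp (((π / 4 : ℝ) : ℂ) * I) = ((Real.sqrt 2 / 2 : ℝ) : ℂ) * (1 + I) ∧
      cexp (((-(π / 4) : ℝ) : ℂ) * I) = ((Real.sqrt 2 / 2 : ℝ) : ℂ) * (1 - I) := by
  constructor
  · rw [Complex.exp_mul_I, ← Complex.ofReal_cos, ← Complex.ofReal_sin, Real.cos_pi_div_four,
      Real.sin_pi_div_four]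
    ring
  · rw [Complex.exp_mul_I, ← Complex.ofReal_cos, ← Complex.ofReal_sin, Real.cos_neg, Real.sin_neg,
      Real.cos_pi_div_four, Real.sin_pi_div_four]
    push_cast
    ring

/-- **`G_{-π/4, π/4}` is the tree's isoradial square lattice** `squareLatticeEmbedding`
(`√2 ℤ²`, faces centred at `√2 (f + (1+i)/2)`): with all vertical tracks of side `e^{-iπ/4}` and
all horizontal tracks of side `e^{iπ/4}`, `v_{i,j} = i e^{-iπ/4} + j e^{iπ/4} = √2 (x + iy)`.
[cite: GrimmettManolescu2014Isoradial, §4.3.1 (the square lattice as an isoradial square lattice)] -/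
theorem gmEmbedding_squareLattice :
    gmEmbedding (fun _ => -(π / 4)) (fun _ => π / 4) = squareLatticeEmbedding := by
  obtain ⟨hp, hm⟩ := exp_pi_div_four_mul_I
  have hz : ∀ x : Site 2, gmVertex (fun _ => -(π / 4)) (fun _ => π / 4) x = Real.sqrt 2 * Site.toComplex x := by
    intro x
    rw [gmVertex, gmDiamond, trackHeight_const, trackHeight_const, hp, hm]
    apply Complex.ext <;> simp <;> ring
  have hc : ∀ f : Site 2, gmFace (fun _ => -(π / 4)) (fun _ => π / 4) f =
      Real.sqrt 2 * (Site.toComplex f + (1 + I) / 2) := by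
    intro f
    rw [gmFace_self, hz, hp]
    push_cast
    ring
  unfold gmEmbedding squareLatticeEmbedding
  congr 1
  · funext x; exact hz x
  · funext f; exact hc f

/-- The abstract square lattice is connected. [folklore] -/
theorem gmEmbedding_preconnected : (zdGraph 2).Preconnected := zdGraph_preconnected_holds

end Literature.Probability.Percolation
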